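import Literature.NumberTheory.Sieve.SmoothArcClassesCRT
import Mathlib.Data.Nat.Factorization.Basic
import HarnessLib

/-!
# Class uniformity of `a`-summed products of class-restricted weighted local factors

Topic `Literature/NumberTheory/Sieve`; a PROVED algebraic tool file continuing `SmoothArcClassesMajorant` and
`SmoothArcClassesCRT` (generic finite exponential-sum algebra behind [MontgomeryVaughanActa1975, §5–6] and
[Harper2016, §2.2, §5]). Notation: `L = lcm(k, m)`, `e(x) = exp(2πix)`, `c_n(h)` = `ramanujanSum n h`,
`C_g(h) = classGcdSum m r k h g`, `μ` = Möbius.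

* `classWeightedSum W m r k h = Σ_{t mod L, t ≡ r (m)} e(ht/k) W((t, L))`: the class-restricted local factor with
  ARBITRARY gcd-weights `W : ℕ → ℂ` (`classLocalFactor α m r k h` is the case
  `W(g) = g^{−α} ∏_{p ∣ L/g}(1 − p^{−α})/φ(L/g)`, `classLocalFactor_eq_classWeightedSum`);
  `classWeightedSum_eq_sum_divisors`: `= Σ_{g ∣ L} C_g(h) W(g)`; it depends on `h` only mod `k`
  (`classWeightedSum_congr_intModEq`) and on `r` only mod `m` (`classWeightedSum_congr_class`).
* `classWeightedSum_mul_of_coprime_of_unit`: the CRT factorisation `k = k₁k₂`, `m = m₁m₂`, `(k₁m₁, k₂m₂) = 1`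
  when the class `r (mod m₁)` consists of units mod `L₁ = lcm(k₁, m₁)` (e.g. `m₁ = q` prime, `k₁ = q^j`, `q ∤ r`):
  the weights do not see the first coordinate, and
  `classWeightedSum W (m₁m₂) r (k₁k₂) h = [Σ_{τ mod L₁, τ ≡ r (m₁)} e(hu₁τ/k₁)] · classWeightedSum W m₂ r k₂ (hu₂)`.
* `sum_coprime_eq_mul_of_periodic`: CRT for sums over the units mod `k₁k₂`.
* `sum_coprime_classWeightedSum_one_mul_eq_moebius` (the `q`-part): for a prime `q`, `q ∣ c₁`, `q ∤ c₂s`: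
  `Σ_{a mod q^j, (a, q) = 1} A_r(c₁a) A_s(c₂a) = μ(q^j)` with `A_r(h') = Σ_{τ mod lcm(q^j, q), τ ≡ r (q)} e(h'τ/q^j)`:
  for `j ≥ 1` every `c_{q^j}(a(c₁τ₁ + c₂τ₂))` met equals `μ(q^j)`, because a unit is never `≡ 0 (mod q)`.
* **Class uniformity** (`sum_coprime_classWeightedSum_mul_eq_moebius_mul`, `sum_coprime_classWeightedSum_mul_eq`,
  `sum_coprime_classWeightedSum_mul_eq_zero`): for an odd prime `q`, `k = q^j k'` (`q ∤ k'`), `v ≥ 1`, `q ∤ D₂`,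
  ARBITRARY `W₁, W₂ : ℕ → ℂ`, `D₁ ∈ ℤ`, and unit classes `r, s (mod 2q)`:
  `Σ_{a mod k, (a,k)=1} classWeightedSum W₁ (2q) r k (D₁q^v a) · classWeightedSum W₂ (2q) s k (D₂a)`
  `= μ(q^j) · Σ_{b mod k', (b,k')=1} classWeightedSum W₁ 2 1 k' (D₁q^v u b) · classWeightedSum W₂ 2 1 k' (D₂ub)`
  (`u q^j ≡ 1 (mod k')`); in particular the left side is INDEPENDENT of the unit classes `(r, s)`, and it
  VANISHES when `q² ∣ k` (`μ(q^j) = 0` for `j ≥ 2`). In the circle method for `d₁n₁ ± d₂n₂ = d₃n₃` in friable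
  integers with `n₁, n₂` in prescribed unit classes mod `2q`, this makes the pure-principal part of every major
  arc `a/k` class-independent, whatever the values `W_i(g)` of the friable twist sums.

The pointwise vanishing of `classWeightedSum W (2q) s k h` for `q² ∣ k`, `q ∤ h`, the free factors (`m = 1`), the
uniformity of triple products, conjugate factors and the closed form without the CRT unit `u` are in
`SmoothArcClassUniformityFree`.

## References

* H. L. Montgomery, R. C. Vaughan, Acta Arith. 27 (1975), §5–6 [MontgomeryVaughanActa1975].
* A. J. Harper, Compositio Math. 152 (2016), §2.2, §5 [Harper2016].
-/

noncomputable section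

open Finset Real Complex
open scoped ArithmeticFunction.Moebius FourierTransform

namespace Literature.NumberTheory.Sieve

namespace SmoothArcs

/-! ### The weighted class sum -/

/-- Class-restricted local factor with ARBITRARY gcd-weights: `Σ_{t mod L, t ≡ r (m)} e(ht/k) W(gcd(t,L))`, `L = lcm(k,m)`
(for `W g = g^{−α}Π_{p∣L/g}(1−p^{−α})/φ(L/g)` this is `classLocalFactor`). [cite: Harper2016, §2.2] -/
def classWeightedSum (W : ℕ → ℂ) (m r k : ℕ) (h : ℤ) : ℂ :=
  ∑ t ∈ (Finset.range (Nat.lcm k m)).filter (fun t => t ≡ r [MOD m]), (𝐞 ((h * t : ℝ) / k) : ℂ) * W (Nat.gcd t (Nat.lcm k m))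

/-- Divisor form: `classWeightedSum W m r k h = Σ_{g ∣ L} C_g(h) W(g)` (`sum_class_mul_apply_gcd_eq_sum_divisors`).
[folklore] -/
theorem classWeightedSum_eq_sum_divisors (W : ℕ → ℂ) (m r k : ℕ) (h : ℤ) :
    classWeightedSum W m r k h = ∑ g ∈ (Nat.lcm k m).divisors, classGcdSum m r k h g * W g :=
  sum_class_mul_apply_gcd_eq_sum_divisors m r k h W

/-- `classLocalFactor` is the weighted class sum with `W(g) = g^{−α} ∏_{p ∣ L/g}(1 − p^{−α})/φ(L/g)`. [folklore] -/
theorem classLocalFactor_eq_classWeightedSum (α : ℝ) (m r k : ℕ) (h : ℤ) :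
    classLocalFactor α m r k h = classWeightedSum
      (fun g => ((((g : ℕ) : ℝ) ^ (-α) * (∏ p ∈ (Nat.lcm k m / g).primeFactors, (1 - (p : ℝ) ^ (-α))) /
        ((Nat.lcm k m / g).totient : ℝ) : ℝ) : ℂ)) m r k h :=
  rfl

/-- `e(ht/k) = e(h't/k)` when `h ≡ h' (mod k)` (for `k = 0` both sides are `e(0)`). [folklore] -/
theorem fourierChar_mul_div_eq_of_intModEq {k : ℕ} {h h' : ℤ} (hh : h ≡ h' [ZMOD k]) (t : ℕ) :
    (𝐞 ((h * t : ℝ) / k) : ℂ) = (𝐞 ((h' * t : ℝ) / k) : ℂ) := by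
  rcases eq_or_ne k 0 with rfl | hk
  · simp
  obtain ⟨c, hc⟩ := Int.modEq_iff_dvd.mp hh.symm
  have hk' : (k : ℝ) ≠ 0 := by exact_mod_cast hk
  have hc' : (h : ℝ) = h' + k * c := by
    have e := congrArg (Int.cast : ℤ → ℝ) hc
    push_cast at e
    linarith
  have key : (h * t : ℝ) / k = (h' * t : ℝ) / k + ((c * t : ℤ) : ℝ) := by
    rw [hc']
    push_cast
    field_simp
  rw [key, AddChar.map_add_eq_mul, Circle.coe_mul, RamanujanSum.fourierChar_intCast, mul_one]

/-- `e(ht) = 1` for `h ∈ ℤ`, `t ∈ ℕ`. [folklore] -/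
theorem fourierChar_intCast_mul_natCast (h : ℤ) (t : ℕ) : (𝐞 ((h : ℝ) * t) : ℂ) = 1 := by
  have e : ((h : ℝ) * t) = ((h * t : ℤ) : ℝ) := by push_cast; ring
  rw [e, RamanujanSum.fourierChar_intCast]

/-- `e(x) e(y) = e(z)` whenever `x + y = z`. [folklore] -/
theorem fourierChar_mul_eq_of_add_eq {x y z : ℝ} (hz : x + y = z) : (𝐞 x : ℂ) * (𝐞 y : ℂ) = (𝐞 z : ℂ) := by
  rw [← hz, AddChar.map_add_eq_mul, Circle.coe_mul]

/-- `classWeightedSum W m r k h` depends on `h` only through `h mod k`. [folklore] -/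
theorem classWeightedSum_congr_intModEq (W : ℕ → ℂ) (m r : ℕ) {k : ℕ} {h h' : ℤ} (hh : h ≡ h' [ZMOD k]) :
    classWeightedSum W m r k h = classWeightedSum W m r k h' :=
  Finset.sum_congr rfl fun t _ => by rw [fourierChar_mul_div_eq_of_intModEq hh t]

/-- … and on the class `r` only through `r mod m`. [folklore] -/
theorem classWeightedSum_congr_class (W : ℕ → ℂ) {m r r' : ℕ} (hr : r ≡ r' [MOD m]) (k : ℕ) (h : ℤ) :
    classWeightedSum W m r k h = classWeightedSum W m r' k h :=
  Finset.sum_congr (Finset.filter_congr fun _ _ => ⟨fun ht => ht.trans hr, fun ht => ht.trans hr.symm⟩)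
    fun _ _ => rfl

/-! ### CRT factorisation with a unit coordinate -/

/-- **CRT factorisation with a unit first coordinate.** For `k_i, m_i ≥ 1`, `(k₁m₁, k₂m₂) = 1`, `u₁k₂ ≡ 1 (k₁)`,
`u₂k₁ ≡ 1 (k₂)`, and a class `r (mod m₁)` all of whose members are prime to `L₁ = lcm(k₁, m₁)`:
`classWeightedSum W (m₁m₂) r (k₁k₂) h = [Σ_{τ < L₁, τ ≡ r (m₁)} e(hu₁τ/k₁)] · classWeightedSum W m₂ r k₂ (hu₂)`
(`t ↔ (t mod L₁, t mod L₂)`, `(t, L₁L₂) = (t mod L₁, L₁)(t mod L₂, L₂) = (t mod L₂, L₂)`). [folklore] -/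
theorem classWeightedSum_mul_of_coprime_of_unit (W : ℕ → ℂ) {k₁ k₂ m₁ m₂ : ℕ} (hk₁ : k₁ ≠ 0) (hk₂ : k₂ ≠ 0)
    (hm₁ : m₁ ≠ 0) (hm₂ : m₂ ≠ 0) (hc : (k₁ * m₁).Coprime (k₂ * m₂)) {r : ℕ}
    (hr : ∀ t, t ≡ r [MOD m₁] → t.Coprime (Nat.lcm k₁ m₁)) {h u₁ u₂ : ℤ}
    (hu₁ : u₁ * k₂ ≡ 1 [ZMOD k₁]) (hu₂ : u₂ * k₁ ≡ 1 [ZMOD k₂]) :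
    classWeightedSum W (m₁ * m₂) r (k₁ * k₂) h =
      classWeightedSum 1 m₁ r k₁ (h * u₁) * classWeightedSum W m₂ r k₂ (h * u₂) := by
  have hL : (Nat.lcm k₁ m₁).Coprime (Nat.lcm k₂ m₂) := coprime_lcm_lcm hc
  have hL₁ : Nat.lcm k₁ m₁ ≠ 0 := Nat.lcm_ne_zero hk₁ hm₁
  have hL₂ : Nat.lcm k₂ m₂ ≠ 0 := Nat.lcm_ne_zero hk₂ hm₂
  have hk : k₁.Coprime k₂ := (hc.coprime_dvd_left (dvd_mul_right _ _)).coprime_dvd_right (dvd_mul_right _ _)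
  unfold classWeightedSum
  rw [lcm_mul_mul_eq_lcm_mul_lcm hc, Finset.sum_mul_sum,
    ← sum_filter_modEq_crt hL hL₁ hL₂ (Nat.dvd_lcm_right k₁ m₁) (Nat.dvd_lcm_right k₂ m₂)]
  refine Finset.sum_congr rfl fun t ht => ?_
  obtain ⟨-, htr⟩ := Finset.mem_filter.mp ht
  have h1 : Nat.gcd (t % Nat.lcm k₁ m₁) (Nat.lcm k₁ m₁) = 1 := by
    rw [← Nat.gcd_rec, Nat.gcd_comm]
    exact hr t (htr.of_mul_right m₂)
  rw [gcd_mul_of_coprime' hL t, h1, one_mul, fourierChar_div_mul_eq_mul hk hk₁ hk₂ hu₁ hu₂ h t,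
    fourierChar_mul_div_of_mod_eq (n := t) (t := t % Nat.lcm k₁ m₁) hk₁ (Nat.dvd_lcm_left k₁ m₁) rfl (h * u₁),
    fourierChar_mul_div_of_mod_eq (n := t) (t := t % Nat.lcm k₂ m₂) hk₂ (Nat.dvd_lcm_left k₂ m₂) rfl (h * u₂)]
  simp only [Pi.one_apply, mul_one, mul_assoc]

/-- Members of a class `t (mod q)` with `(t, q) = 1` are prime to `lcm(q^j, q)`. [folklore] -/
theorem coprime_lcm_pow_of_modEq {q : ℕ} (j : ℕ) {t : ℕ} (ht : t.Coprime q) (x : ℕ) (hx : x ≡ t [MOD q]) :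
    x.Coprime (Nat.lcm (q ^ j) q) := by
  have hxq : x.Coprime q := by rw [Nat.Coprime, hx.gcd_eq]; exact ht
  exact (Nat.Coprime.mul_right (hxq.pow_right j) hxq).coprime_dvd_right (Nat.lcm_dvd_mul _ _)

/-- `(q^j · q, k' · 2) = 1` for an odd prime `q ∤ k'`. [folklore] -/
theorem coprime_pow_mul_self_mul_two {q : ℕ} (hq : q.Prime) (hq2 : q ≠ 2) {k' : ℕ} (hqk' : ¬ q ∣ k') (j : ℕ) :
    (q ^ j * q).Coprime (k' * 2) :=
  have h : q.Coprime (k' * 2) :=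
    Nat.Coprime.mul_right ((Nat.Prime.coprime_iff_not_dvd hq).mpr hqk')
      ((Nat.coprime_primes hq Nat.prime_two).mpr hq2)
  Nat.Coprime.mul_left (h.pow_left j) h

/-- A CRT unit `u₁` with `u₁k' ≡ 1 (mod q^j)`, `j ≥ 1`, is prime to the prime `q`: `q ∤ h ⟹ q ∤ hu₁`. [folklore] -/
theorem not_dvd_mul_crt_unit {q : ℕ} (hq : q.Prime) {j : ℕ} (hj : j ≠ 0) {k' : ℕ} {u₁ : ℤ}
    (hu₁ : u₁ * k' ≡ 1 [ZMOD (q ^ j : ℕ)]) {h : ℤ} (hh : ¬ (q : ℤ) ∣ h) : ¬ (q : ℤ) ∣ h * u₁ := by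
  intro hdvd
  rcases (Nat.prime_iff_prime_int.mp hq).dvd_mul.mp hdvd with h1 | h1
  · exact hh h1
  · have h2 : (q : ℤ) ∣ u₁ * k' - 1 := by
      refine dvd_trans ?_ hu₁.symm.dvd
      rw [Nat.cast_pow]
      exact dvd_pow_self _ hj
    have h3 : (q : ℤ) ∣ 1 := by
      have := dvd_sub (dvd_mul_of_dvd_left h1 (k' : ℤ)) h2
      rwa [sub_sub_cancel] at this
    exact hq.ne_one (by exact_mod_cast Int.eq_one_of_dvd_one (Int.natCast_nonneg q) h3)

/-! ### CRT for sums over units -/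

/-- Every `t` lies in every class mod `1`. [folklore] -/
theorem filter_modEq_one (s : Finset ℕ) (r : ℕ) : s.filter (fun t => t ≡ r [MOD 1]) = s :=
  Finset.filter_true_of_mem fun _ _ => Nat.modEq_one

/-- CRT on a full range: `Σ_{t < L₁L₂} f(t mod L₁, t mod L₂) = Σ_{t₁ < L₁} Σ_{t₂ < L₂} f(t₁, t₂)` for coprime
`L₁, L₂ ≥ 1`. [folklore] -/
theorem sum_range_crt {M : Type*} [AddCommMonoid M] {L₁ L₂ : ℕ} (hL : L₁.Coprime L₂) (hL₁ : L₁ ≠ 0)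
    (hL₂ : L₂ ≠ 0) (f : ℕ → ℕ → M) :
    ∑ t ∈ Finset.range (L₁ * L₂), f (t % L₁) (t % L₂) =
      ∑ t₁ ∈ Finset.range L₁, ∑ t₂ ∈ Finset.range L₂, f t₁ t₂ := by
  have h1 := sum_filter_modEq_crt (m₁ := 1) (m₂ := 1) hL hL₁ hL₂ (one_dvd L₁) (one_dvd L₂) 0 f
  rwa [mul_one, filter_modEq_one, filter_modEq_one, filter_modEq_one] at h1

/-- **CRT for sums over units.** For coprime `k₁, k₂ ≥ 1` and `F(a) = f(a) g(a)` with `f` (`g`) depending on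
`a` only mod `k₁` (mod `k₂`):
`Σ_{a < k₁k₂, (a, k₁k₂) = 1} F(a) = (Σ_{a₁ < k₁, (a₁, k₁) = 1} f(a₁)) (Σ_{a₂ < k₂, (a₂, k₂) = 1} g(a₂))`. [folklore] -/
theorem sum_coprime_eq_mul_of_periodic {k₁ k₂ : ℕ} (hk : k₁.Coprime k₂) (hk₁ : k₁ ≠ 0) (hk₂ : k₂ ≠ 0)
    {F f g : ℕ → ℂ} (hF : ∀ a, F a = f a * g a) (hf : ∀ a b, a ≡ b [MOD k₁] → f a = f b)
    (hg : ∀ a b, a ≡ b [MOD k₂] → g a = g b) :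
    ∑ a ∈ (Finset.range (k₁ * k₂)).filter (Nat.Coprime (k₁ * k₂)), F a =
      (∑ a ∈ (Finset.range k₁).filter (Nat.Coprime k₁), f a) *
        ∑ a ∈ (Finset.range k₂).filter (Nat.Coprime k₂), g a := by
  have hmod : ∀ n a : ℕ, Nat.Coprime n a ↔ Nat.Coprime n (a % n) := fun n a => by
    unfold Nat.Coprime
    rw [Nat.gcd_rec n a, Nat.gcd_comm (a % n) n]
  rw [Finset.sum_filter, Finset.sum_filter, Finset.sum_filter, Finset.sum_mul_sum,
    ← sum_range_crt hk hk₁ hk₂ (fun a b => (if k₁.Coprime a then f a else 0) * (if k₂.Coprime b then g b else 0))]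
  refine Finset.sum_congr rfl fun a _ => ?_
  rw [hF a, ← hf _ _ (Nat.mod_modEq a k₁), ← hg _ _ (Nat.mod_modEq a k₂)]
  by_cases h₁ : k₁.Coprime (a % k₁)
  · by_cases h₂ : k₂.Coprime (a % k₂)
    · rw [if_pos (Nat.coprime_mul_iff_left.mpr ⟨(hmod k₁ a).mpr h₁, (hmod k₂ a).mpr h₂⟩), if_pos h₁, if_pos h₂]
    · rw [if_neg fun h => h₂ ((hmod k₂ a).mp (Nat.coprime_mul_iff_left.mp h).2), if_pos h₁, if_neg h₂, mul_zero]
  · rw [if_neg fun h => h₁ ((hmod k₁ a).mp (Nat.coprime_mul_iff_left.mp h).1), if_neg h₁, zero_mul]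

/-! ### The `q`-part -/

/-- The classes mod `m ≥ 1` within `[0, m)` are singletons: `{t < m : t ≡ r (m)} = {r mod m}`. [folklore] -/
theorem filter_range_modEq_eq_singleton {m : ℕ} (hm : m ≠ 0) (r : ℕ) :
    (Finset.range m).filter (fun t => t ≡ r [MOD m]) = {r % m} := by
  ext t
  simp only [Finset.mem_filter, Finset.mem_range, Finset.mem_singleton, Nat.ModEq]
  constructor
  · rintro ⟨ht, htr⟩
    rw [← htr, Nat.mod_eq_of_lt ht]
  · rintro rfl
    exact ⟨Nat.mod_lt r (Nat.pos_of_ne_zero hm), Nat.mod_mod r m⟩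

/-- `c_n(h)` with the unit filter written as `Nat.Coprime n a`: `c_n(h) = Σ_{a < n, (n, a) = 1} e(ah/n)`. [folklore] -/
theorem ramanujanSum_eq_sum_filter_coprime (n : ℕ) (h : ℤ) :
    ramanujanSum n h = ∑ a ∈ (Finset.range n).filter (Nat.Coprime n), (𝐞 ((a : ℝ) * h / n) : ℂ) :=
  Finset.sum_congr (Finset.filter_congr fun _ _ => Nat.coprime_comm) fun _ _ => rfl

/-- The `q`-part at level `1` (`j = 0`): `classWeightedSum 1 q r 1 h = #{τ < q : τ ≡ r (q)} = 1` for `q ≥ 1`. [folklore] -/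
theorem classWeightedSum_one_one_eq_one {q : ℕ} (hq : q ≠ 0) (r : ℕ) (h : ℤ) :
    classWeightedSum 1 q r 1 h = 1 := by
  unfold classWeightedSum
  rw [Nat.lcm_one_left, filter_range_modEq_eq_singleton hq r, Finset.sum_singleton]
  simp only [Nat.cast_one, div_one, Pi.one_apply, mul_one, fourierChar_intCast_mul_natCast]

/-- **The `q`-part.** For a prime `q`, any `j`, classes `r, s` with `q ∤ s`, `q ∣ c₁` and (if `j ≥ 1`) `q ∤ c₂`:
`Σ_{a < q^j, (a, q^j) = 1} A_r(c₁a) A_s(c₂a) = μ(q^j)`, where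
`A_r(h') = classWeightedSum 1 q r (q^j) h' = Σ_{τ < lcm(q^j, q), τ ≡ r (q)} e(h'τ/q^j)`: for `j = 0` all three sums
are singletons of ones; for `j ≥ 1` the `a`-sum of `e(a(c₁τ₁ + c₂τ₂)/q^j)` is `c_{q^j}(c₁τ₁ + c₂τ₂) = μ(q^j)`
since `q ∤ c₁τ₁ + c₂τ₂` (`q ∣ c₁`, `q ∤ c₂τ₂`), and `μ(q^j) = 0` unless `j = 1`, when the classes are singletons.
[folklore] -/
theorem sum_coprime_classWeightedSum_one_mul_eq_moebius {q : ℕ} (hq : q.Prime) (j r : ℕ) {s : ℕ}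
    (hs : s.Coprime q) {c₁ c₂ : ℤ} (hc₁ : (q : ℤ) ∣ c₁) (hc₂ : j ≠ 0 → ¬ (q : ℤ) ∣ c₂) :
    ∑ a ∈ (Finset.range (q ^ j)).filter (Nat.Coprime (q ^ j)),
        classWeightedSum 1 q r (q ^ j) (c₁ * a) * classWeightedSum 1 q s (q ^ j) (c₂ * a) = (μ (q ^ j) : ℂ) := by
  have hq0 : q ≠ 0 := hq.ne_zero
  rcases Nat.eq_zero_or_pos j with rfl | hj
  · rw [pow_zero, ArithmeticFunction.moebius_apply_one, Int.cast_one, Finset.range_one,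
      Finset.filter_true_of_mem fun a _ => Nat.coprime_one_left a, Finset.sum_singleton,
      classWeightedSum_one_one_eq_one hq0, classWeightedSum_one_one_eq_one hq0, mul_one]
  have hj0 : j ≠ 0 := hj.ne'
  have hlcm : Nat.lcm (q ^ j) q = q ^ j := Nat.lcm_eq_left (dvd_pow_self q hj0)
  -- each Ramanujan sum met equals `μ(q^j)`
  have hram : ∀ τ₁ : ℕ, ∀ τ₂ ∈ (Finset.range (q ^ j)).filter (fun t => t ≡ s [MOD q]),
      ramanujanSum (q ^ j) (c₁ * τ₁ + c₂ * τ₂) = (μ (q ^ j) : ℂ) := by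
    intro τ₁ τ₂ hτ₂
    obtain ⟨-, hτ₂s⟩ := Finset.mem_filter.mp hτ₂
    refine ramanujanSum_eq_moebius_of_coprime_natAbs (Nat.Coprime.pow_left j ?_)
    rw [Nat.Prime.coprime_iff_not_dvd hq, ← Int.natCast_dvd]
    intro hdvd
    have h2 : (q : ℤ) ∣ c₂ * τ₂ := (dvd_add_right (dvd_mul_of_dvd_left hc₁ _)).mp hdvd
    rcases (Nat.prime_iff_prime_int.mp hq).dvd_mul.mp h2 with h3 | h3
    · exact hc₂ hj0 h3
    · have hτq : τ₂.Coprime q := by rw [Nat.Coprime, hτ₂s.gcd_eq]; exact hs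
      exact (Nat.Prime.coprime_iff_not_dvd hq).mp hτq.symm (Int.natCast_dvd_natCast.mp h3)
  -- exchange the order of summation: the `a`-sum is a Ramanujan sum
  have step : ∑ a ∈ (Finset.range (q ^ j)).filter (Nat.Coprime (q ^ j)),
      classWeightedSum 1 q r (q ^ j) (c₁ * a) * classWeightedSum 1 q s (q ^ j) (c₂ * a) =
      ∑ τ₁ ∈ (Finset.range (q ^ j)).filter (fun t => t ≡ r [MOD q]),
        ∑ τ₂ ∈ (Finset.range (q ^ j)).filter (fun t => t ≡ s [MOD q]),
          ramanujanSum (q ^ j) (c₁ * τ₁ + c₂ * τ₂) := by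
    unfold classWeightedSum
    simp only [hlcm, Pi.one_apply, mul_one, Finset.sum_mul_sum]
    rw [Finset.sum_comm]
    refine Finset.sum_congr rfl fun τ₁ _ => ?_
    rw [Finset.sum_comm]
    refine Finset.sum_congr rfl fun τ₂ _ => ?_
    rw [ramanujanSum_eq_sum_filter_coprime]
    refine Finset.sum_congr rfl fun a _ => fourierChar_mul_eq_of_add_eq ?_
    push_cast
    ring
  rw [step, Finset.sum_congr rfl fun τ₁ _ => Finset.sum_congr rfl (hram τ₁)]
  rcases eq_or_ne j 1 with rfl | hj1
  · rw [pow_one, filter_range_modEq_eq_singleton hq0, filter_range_modEq_eq_singleton hq0, Finset.sum_singleton,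
      Finset.sum_singleton]
  · rw [ArithmeticFunction.moebius_apply_prime_pow hq hj0, if_neg hj1, Int.cast_zero]
    simp

/-! ### Class uniformity -/

/-- **Class uniformity, closed form.** For an odd prime `q`, `k = q^j k'` with `q ∤ k'`, `k' ≥ 1`, CRT units
`u₁k' ≡ 1 (mod q^j)`, `u₂q^j ≡ 1 (mod k')`, `v ≥ 1`, `q ∤ D₂`, any `D₁ ∈ ℤ`, ARBITRARY weights `W₁, W₂` and
unit classes `r, s (mod 2q)`:
`Σ_{a < k, (a,k)=1} classWeightedSum W₁ (2q) r k (D₁q^v a) · classWeightedSum W₂ (2q) s k (D₂a)`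
`= μ(q^j) · Σ_{b < k', (b,k')=1} classWeightedSum W₁ 2 1 k' (D₁q^v u₂ b) · classWeightedSum W₂ 2 1 k' (D₂u₂b)`
(`ε_j = μ(q^j) = 1, −1, 0` for `j = 0`, `j = 1`, `j ≥ 2`; the right side does not mention `r, s`). [folklore] -/
theorem sum_coprime_classWeightedSum_mul_eq_moebius_mul {q : ℕ} (hq : q.Prime) (hq2 : q ≠ 2) {j k' : ℕ}
    (hk' : k' ≠ 0) (hqk' : ¬ q ∣ k') {u₁ u₂ : ℤ} (hu₁ : u₁ * k' ≡ 1 [ZMOD (q ^ j : ℕ)])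
    (hu₂ : u₂ * (q ^ j : ℕ) ≡ 1 [ZMOD k']) {v : ℕ} (hv : 1 ≤ v) (D₁ : ℤ) {D₂ : ℤ} (hD₂ : ¬ (q : ℤ) ∣ D₂)
    (W₁ W₂ : ℕ → ℂ) {r s : ℕ} (hr : r.Coprime (2 * q)) (hs : s.Coprime (2 * q)) :
    ∑ a ∈ (Finset.range (q ^ j * k')).filter (Nat.Coprime (q ^ j * k')),
        classWeightedSum W₁ (2 * q) r (q ^ j * k') (D₁ * q ^ v * a) *
          classWeightedSum W₂ (2 * q) s (q ^ j * k') (D₂ * a) =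
      (μ (q ^ j) : ℂ) * ∑ b ∈ (Finset.range k').filter (Nat.Coprime k'),
        classWeightedSum W₁ 2 1 k' (D₁ * q ^ v * u₂ * b) * classWeightedSum W₂ 2 1 k' (D₂ * u₂ * b) := by
  have hq0 : q ≠ 0 := hq.ne_zero
  have hqj : q ^ j ≠ 0 := pow_ne_zero j hq0
  have hqk : q.Coprime k' := (Nat.Prime.coprime_iff_not_dvd hq).mpr hqk'
  -- factorisation of one class-restricted factor into its `q`-part and its level-`k'` part
  have fac : ∀ (W : ℕ → ℂ) {t : ℕ} (_ : t.Coprime (2 * q)) (c : ℤ) (a : ℕ),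
      classWeightedSum W (q * 2) t (q ^ j * k') (c * a) =
        classWeightedSum 1 q t (q ^ j) (c * u₁ * a) * classWeightedSum W 2 1 k' (c * u₂ * a) := by
    intro W t ht c a
    have ht2 : ¬ 2 ∣ t := fun h2 => by
      have := Nat.eq_one_of_dvd_coprimes ht h2 (dvd_mul_right 2 q)
      omega
    have ht1 : t ≡ 1 [MOD 2] := by unfold Nat.ModEq; omega
    rw [classWeightedSum_mul_of_coprime_of_unit W hqj hk' hq0 two_ne_zero (coprime_pow_mul_self_mul_two hq hq2 hqk' j)
      (coprime_lcm_pow_of_modEq j (ht.coprime_dvd_right (dvd_mul_left q 2))) hu₁ hu₂,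
      mul_right_comm c (a : ℤ) u₁, mul_right_comm c (a : ℤ) u₂, classWeightedSum_congr_class W ht1]
  -- the summand splits as (function of `a mod q^j`) × (function of `a mod k'`)
  have hF : ∀ a : ℕ, classWeightedSum W₁ (q * 2) r (q ^ j * k') (D₁ * q ^ v * a) *
      classWeightedSum W₂ (q * 2) s (q ^ j * k') (D₂ * a) =
      classWeightedSum 1 q r (q ^ j) (D₁ * q ^ v * u₁ * a) * classWeightedSum 1 q s (q ^ j) (D₂ * u₁ * a) *
        (classWeightedSum W₁ 2 1 k' (D₁ * q ^ v * u₂ * a) * classWeightedSum W₂ 2 1 k' (D₂ * u₂ * a)) := by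
    intro a
    rw [fac W₁ hr, fac W₂ hs]
    ring
  have hmodz : ∀ {n a b : ℕ} (c : ℤ), a ≡ b [MOD n] → c * a ≡ c * b [ZMOD n] := fun c hab =>
    Int.ModEq.mul_left c (Int.natCast_modEq_iff.mpr hab)
  have hc₁ : (q : ℤ) ∣ D₁ * q ^ v * u₁ :=
    dvd_mul_of_dvd_left (dvd_mul_of_dvd_right (dvd_pow_self (q : ℤ) (by omega)) D₁) u₁
  rw [mul_comm 2 q, sum_coprime_eq_mul_of_periodic (Nat.Coprime.pow_left j hqk) hqj hk' hF
      (fun a b hab => by rw [classWeightedSum_congr_intModEq 1 q r (hmodz (D₁ * q ^ v * u₁) hab),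
        classWeightedSum_congr_intModEq 1 q s (hmodz (D₂ * u₁) hab)])
      (fun a b hab => by rw [classWeightedSum_congr_intModEq W₁ 2 1 (hmodz (D₁ * q ^ v * u₂) hab),
        classWeightedSum_congr_intModEq W₂ 2 1 (hmodz (D₂ * u₂) hab)]),
    sum_coprime_classWeightedSum_one_mul_eq_moebius hq j r (hs.coprime_dvd_right (dvd_mul_left q 2)) hc₁
      fun hj0 => not_dvd_mul_crt_unit hq hj0 hu₁ hD₂]

/-- **Class uniformity.** For an odd prime `q`, any `k`, `v ≥ 1`, any `D₁ ∈ ℤ`, `q ∤ D₂`, ARBITRARY weights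
`W₁, W₂ : ℕ → ℂ`, and unit classes `r, s, r', s' (mod 2q)`:
`Σ_{a < k, (a,k)=1} classWeightedSum W₁ (2q) r k (D₁q^v a) · classWeightedSum W₂ (2q) s k (D₂a)` takes the same
value for `(r, s)` and `(r', s')` — the `a`-summed product of two class-restricted weighted local factors does not
depend on the unit classes. [folklore] -/
theorem sum_coprime_classWeightedSum_mul_eq {q : ℕ} (hq : q.Prime) (hq2 : q ≠ 2) (k : ℕ) {v : ℕ} (hv : 1 ≤ v)
    (D₁ : ℤ) {D₂ : ℤ} (hD₂ : ¬ (q : ℤ) ∣ D₂) (W₁ W₂ : ℕ → ℂ) {r s r' s' : ℕ} (hr : r.Coprime (2 * q))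
    (hs : s.Coprime (2 * q)) (hr' : r'.Coprime (2 * q)) (hs' : s'.Coprime (2 * q)) :
    ∑ a ∈ (Finset.range k).filter (Nat.Coprime k),
        classWeightedSum W₁ (2 * q) r k (D₁ * q ^ v * a) * classWeightedSum W₂ (2 * q) s k (D₂ * a) =
      ∑ a ∈ (Finset.range k).filter (Nat.Coprime k),
        classWeightedSum W₁ (2 * q) r' k (D₁ * q ^ v * a) * classWeightedSum W₂ (2 * q) s' k (D₂ * a) := by
  rcases eq_or_ne k 0 with rfl | hk
  · simp
  obtain ⟨j, k', hqk', rfl⟩ := Nat.exists_eq_pow_mul_and_not_dvd hk q hq.one_lt.ne'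
  have hk' : k' ≠ 0 := fun h => hk (by rw [h, mul_zero])
  obtain ⟨u₁, u₂, hu₁, hu₂⟩ :=
    exists_crt_units (Nat.Coprime.pow_left j ((Nat.Prime.coprime_iff_not_dvd hq).mpr hqk'))
  rw [sum_coprime_classWeightedSum_mul_eq_moebius_mul hq hq2 hk' hqk' hu₁ hu₂ hv D₁ hD₂ W₁ W₂ hr hs,
    sum_coprime_classWeightedSum_mul_eq_moebius_mul hq hq2 hk' hqk' hu₁ hu₂ hv D₁ hD₂ W₁ W₂ hr' hs']

/-- **Vanishing for `q² ∣ k`.** Under the hypotheses of `sum_coprime_classWeightedSum_mul_eq`, if `q² ∣ k` the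
`a`-sum vanishes (`μ(q^j) = 0` for `j ≥ 2`). [folklore] -/
theorem sum_coprime_classWeightedSum_mul_eq_zero {q : ℕ} (hq : q.Prime) (hq2 : q ≠ 2) {k : ℕ} (hqk : q ^ 2 ∣ k)
    {v : ℕ} (hv : 1 ≤ v) (D₁ : ℤ) {D₂ : ℤ} (hD₂ : ¬ (q : ℤ) ∣ D₂) (W₁ W₂ : ℕ → ℂ) {r s : ℕ}
    (hr : r.Coprime (2 * q)) (hs : s.Coprime (2 * q)) :
    ∑ a ∈ (Finset.range k).filter (Nat.Coprime k),
        classWeightedSum W₁ (2 * q) r k (D₁ * q ^ v * a) * classWeightedSum W₂ (2 * q) s k (D₂ * a) = 0 := by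
  rcases eq_or_ne k 0 with rfl | hk
  · simp
  obtain ⟨j, k', hqk', rfl⟩ := Nat.exists_eq_pow_mul_and_not_dvd hk q hq.one_lt.ne'
  have hk' : k' ≠ 0 := fun h => hk (by rw [h, mul_zero])
  have hcop : q.Coprime k' := (Nat.Prime.coprime_iff_not_dvd hq).mpr hqk'
  obtain ⟨u₁, u₂, hu₁, hu₂⟩ := exists_crt_units (Nat.Coprime.pow_left j hcop)
  have hj : 2 ≤ j :=
    (Nat.pow_dvd_pow_iff_le_right hq.one_lt).mp ((Nat.Coprime.pow_left 2 hcop).dvd_of_dvd_mul_right hqk)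
  rw [sum_coprime_classWeightedSum_mul_eq_moebius_mul hq hq2 hk' hqk' hu₁ hu₂ hv D₁ hD₂ W₁ W₂ hr hs,
    ArithmeticFunction.moebius_apply_prime_pow hq (by omega), if_neg (by omega), Int.cast_zero, zero_mul]

end SmoothArcs

end Literature.NumberTheory.Sieve

end
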